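import Summits.CriticalPhenomena.Ising3DConformalLimit.Theses.MarkovRigidity
import Literature.Probability.LatticeModels.CriticalScalingDimension

/-! Standalone certification of retarget/glue.lean: the three items to be added are declared here with their verbatim
signatures inside a mirror of the route namespace; `closes'` is retarget/glue.lean's theorem text with the primed name. -/

namespace Summit.CriticalPhenomena.Ising3DConformalLimit.Theses.MarkovRigidity

open scoped BigOperators Topology Manifold Classical MeasureTheory ProbabilityTheory Matrix InnerProductSpace ComplexConjugate ContinuousMap
open Filter Set Function TopologicalSpace MeasureTheory

def NPRInversionIsotropic : Prop :=
  ∀ (μ : MeasureTheory.Measure (Literature.MathematicalPhysics.QuantumLattice.FieldConfig (EuclideanSpace ℝ (Fin 3)))) (Δ : ℝ) (S : Literature.Probability.LatticeModels.CorrFamily 3), MeasureTheory.IsProbabilityMeasure μ → Literature.MathematicalPhysics.QuantumLattice.HasAllMoments μ → (∀ f : SchwartzMap (EuclideanSpace ℝ (Fin 3)) ℝ, MeasureTheory.Integrable (fun ω : Literature.MathematicalPhysics.QuantumLattice.FieldConfig (EuclideanSpace ℝ (Fin 3)) => Real.exp (ω f)) μ) → Literature.MathematicalPhysics.QuantumLattice.IsTranslationInvariantLaw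 μ → (∀ (s : ℝ) (hs : 0 < s), MeasureTheory.Measure.map (Literature.MathematicalPhysics.QuantumLattice.FieldConfig.act ((s ^ (Δ - 3 : ℝ)) • Literature.MathematicalPhysics.QuantumLattice.dilateTest s hs.ne')) μ = μ) → Literature.MathematicalPhysics.QuantumLattice.IsTimeReflectionInvariantLaw 3 μ → (∀ (n : ℕ) (c : Fin n → ℂ) (f : Fin n → SchwartzMap (EuclideanSpace ℝ (Fin 3)) ℝ), (∀ i, tsupport ⇑(f i) ⊆ {x : EuclideanSpace ℝ (Fin 3) | 0 < x 0}) → 0 ≤ (∑ i, ∑ j, (starRingEnd ℂ) (c i) * c j * Literature.MathematicalPhysics.QuantumLattice.genFunctional μ (f j - Literature.MathematicalPhysics.QuantumLattice.thetaTest 3 (f i))).re ∧ (∑ i, ∑ j, (starRingEnd ℂ) (c i) * c j * Literature.MathematicalPhysics.QuantumLattice.genFunctional μ (f j - Literature.MathematicalPhysics.QuantumLattice.thetaTest 3 (f i))).im = 0) → (∀ f g : SchwartzMap (EuclideanSpace ℝ (Fin 3)) ℝ, Filter.Tendsto (fun t : ℝ => Literature.MathematicalPhysics.QuantumLattice.genFunctional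 μ (f + Literature.MathematicalPhysics.QuantumLattice.timeShiftTest 3 t g)) Filter.atTop (nhds (Literature.MathematicalPhysics.QuantumLattice.genFunctional μ f * Literature.MathematicalPhysics.QuantumLattice.genFunctional μ g))) → (∀ (sig : Set (EuclideanSpace ℝ (Fin 3)) → MeasurableSpace (Literature.MathematicalPhysics.QuantumLattice.FieldConfig (EuclideanSpace ℝ (Fin 3)))), (sig = fun A => ⨆ (f : SchwartzMap (EuclideanSpace ℝ (Fin 3)) ℝ) (_ : tsupport ⇑f ⊆ A), MeasurableSpace.comap (fun ω : Literature.MathematicalPhysics.QuantumLattice.FieldConfig (EuclideanSpace ℝ (Fin 3)) => ω f) (borel ℝ)) → ∀ (U : Set (EuclideanSpace ℝ (Fin 3))), ((∃ (c : EuclideanSpace ℝ (Fin 3)) (r : ℝ), U = Metric.ball c r) ∨ (∃ (v : EuclideanSpace ℝ (Fin 3)) (a : ℝ), v ≠ 0 ∧ U = {x | a < inner ℝ x v})) → ∀ (F : Literature.MathematicalPhysics.QuantumLattice.FieldConfig (EuclideanSpace ℝ (Fin 3)) → ℝ), @Measurable _ _ (⨅ (ε : ℝ) (_ : 0 < ε),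 sig (Metric.thickening ε U)) _ F → (∃ C : ℝ, ∀ ω, |F ω| ≤ C) → MeasureTheory.condExp ((⨅ (ε : ℝ) (_ : 0 < ε), sig (Metric.thickening ε Uᶜ)) ⊔ ⨅ (ε : ℝ) (_ : 0 < ε), sig (Metric.thickening ε (frontier U))) μ F =ᵐ[μ] MeasureTheory.condExp (⨅ (ε : ℝ) (_ : 0 < ε), sig (Metric.thickening ε (frontier U))) μ F) → 1 / 2 ≤ Δ → Δ ≤ 1 → (∀ (n : ℕ) (f : Fin n → SchwartzMap (EuclideanSpace ℝ (Fin 3)) ℝ), Literature.MathematicalPhysics.QuantumLattice.moment μ n f = ∫ x : Fin n → EuclideanSpace ℝ (Fin 3), S n x * ∏ i, f i (x i)) → (∀ n z, z ∉ Literature.Probability.LatticeModels.NonCoincident 3 n → S n z = 0) → (∀ n, ContinuousOn (S n) (Literature.Probability.LatticeModels.NonCoincident 3 n)) → Literature.Probability.LatticeModels.IsNondegenerateTwoPoint S → Literature.Probability.LatticeModels.IsEuclideanInvariant S → Literature.Probability.LatticeModels.IsScaleCovariant Δ S → Literature.Probability.LatticeModels.IsInversionCovariant Δ S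

def HRP2Rigidity : Prop :=
  ∀ (Δ : ℝ) (K : EuclideanSpace ℝ (Fin 3) → ℝ), 1/2 ≤ Δ → Δ ≤ 1 → ContinuousOn K {0}ᶜ → (∀ x, x ≠ 0 → 0 < K x) → (∀ c : ℝ, 0 < c → ∀ x, K (c • x) = c ^ (-(2 * Δ)) * K x) → (∀ n : EuclideanSpace ℝ (Fin 3), (∃ i j : Fin 3, i ≠ j ∧ (n = EuclideanSpace.single i 1 ∨ n = EuclideanSpace.single i 1 + EuclideanSpace.single j 1 ∨ n = EuclideanSpace.single i 1 - EuclideanSpace.single j 1)) → (∀ x, K (((ℝ ∙ n)ᗮ).reflection x) = K x) ∧ (∀ (m : ℕ) (p : Fin m → EuclideanSpace ℝ (Fin 3)) (c : Fin m → ℝ), (∀ a, 0 < inner ℝ (p a) n) → 0 ≤ ∑ a, ∑ b, c a * c b * K (p a - ((ℝ ∙ n)ᗮ).reflection (p b)))) → ∀ (R : EuclideanSpace ℝ (Fin 3) ≃ₗᵢ[ℝ] EuclideanSpace ℝ (Fin 3)) (x : EuclideanSpace ℝ (Fin 3)), K (R x) = K x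

def LimitRotationInvariant : Prop :=
  HRP2Rigidity → ∀ (ρ : ℝ → ℝ) (Δ : ℝ) (S : Literature.Probability.LatticeModels.CorrFamily 3), (∀ δ ∈ Set.Ioc (0:ℝ) 1, 0 < ρ δ) → Literature.Probability.LatticeModels.HasPointwiseScalingLimit (Literature.Probability.LatticeModels.criticalCorr 3) ρ S → (∀ n z, z ∉ Literature.Probability.LatticeModels.NonCoincident 3 n → S n z = 0) → Literature.Probability.LatticeModels.IsNondegenerateTwoPoint S → Literature.Probability.LatticeModels.IsTranslationInvariant S → Literature.Probability.LatticeModels.IsScaleCovariant Δ S → Literature.Probability.LatticeModels.IsRotationInvariant S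

/-- dedup sanity: the added copies are the HyperoctahedralRP items by `Iff.rfl`. -/
example : HRP2Rigidity ↔ Summit.CriticalPhenomena.Ising3DConformalLimit.Theses.HyperoctahedralRP.HRP2Rigidity := Iff.rfl
example : LimitRotationInvariant ↔ Summit.CriticalPhenomena.Ising3DConformalLimit.Theses.HyperoctahedralRP.LimitRotationInvariant := Iff.rfl

/-! Re-targeted DECIDING THEOREM for route-CriticalPhenomena-MarkovRigidity (strategist r1 proposal, 2026-08-17).
Items assumed added to the route (verbatim signatures in retarget/*.signature):
  `NPRInversionIsotropic` (new, = Strategist.NPRInv), `HRP2Rigidity` (= item 1979, proved), `LimitRotationInvariant` (= item 1980, proved);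
extra import: `Literature.Probability.LatticeModels.CriticalScalingDimension` (for `scalingDimension_mem_Icc_holds`).
`NelsonPolyakovRigidity` becomes `aside`. Proof = pure logic + the Literature window theorem. -/
theorem closes' : MarkovInheritance → NPRInversionIsotropic → ExistsScaleCovariantLimit → IsingEuclidUpgradeR4NonGaussian → FieldRealisation → HRP2Rigidity → LimitRotationInvariant → _root_.Ising3DConformalLimit := by
  intro hMI hInv hE hNG hFR hA hB
  obtain ⟨ρ, Δ, S, hρ, hΔ, hlim, hnorm, hnd, htr, hsc⟩ := hE
  have hrot : Literature.Probability.LatticeModels.IsRotationInvariant S := hB hA ρ Δ S hρ hlim hnorm hnd htr hsc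
  obtain ⟨hcont, μ, hprob, hmom, hexp, hdens, htrl, hscl, hθ, hRP, hclust⟩ := hFR ρ Δ S hρ hlim hnorm hnd htr hsc
  have hIcc : Δ ∈ Set.Icc (1 / 2 : ℝ) 1 :=
    Literature.Probability.LatticeModels.scalingDimension_mem_Icc_holds ρ Δ S hlim hsc hnd hρ
  have hMarkov := hMI ρ Δ S μ hρ hlim hnorm hnd htr hsc hprob hmom hexp hdens
  have hinv : Literature.Probability.LatticeModels.IsInversionCovariant Δ S :=
    hInv μ Δ S hprob hmom hexp htrl hscl hθ hRP hclust hMarkov hIcc.1 hIcc.2 hdens hnorm hcont hnd ⟨htr, hrot⟩ hsc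
  exact ⟨ρ, Δ, S, hρ, hΔ, hlim, hnd, ⟨⟨htr, hrot⟩, hsc, hinv⟩, hNG ρ S hρ hlim hnd⟩

end Summit.CriticalPhenomena.Ising3DConformalLimit.Theses.MarkovRigidity
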